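import Literature.ComputerArithmetic.Rump2006.CholeskyReciprocalDivision
import Literature.ComputerArithmetic.Rump2026SparseI.SparseCholeskyStoredZeros
import HarnessLib

/-!
# Sparse floating-point Cholesky with RECIPROCAL pivot scaling: the row-count certificate of
# Rump 2026 I (Lemma 2.10) and its stored-zero dress hold with the unit roundoff `2u + u²`

Topic `Literature/ComputerArithmetic`, namespace `Literature.ComputerArithmetic.Rump2026SparseI`.
HONEST FRAMING (cell certnum, CERTIFIED-NUMERICS STACK, D-0105 (6); layer L1 interval linear algebra;
seat certnum-ila-1, author of the engine kernel `cap.ila.spd`): this cell ships TOOLS and SOUNDNESS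
STATEMENTS; every certified number belongs to a client cell's ledger. A typed and PROVED implication in
the standard model; it certifies no engine output. No named facts, no `sorry`.

THE GAP CLOSED HERE. The a-priori `λ_min` floor of `cap.ila.spd` (certificate kind `ila-spd-shift-chol/1`)
reads one shifted SUPERNODAL Cholesky factor of CHOLMOD and evaluates the row-count certificate of
[Rump2026SparseI] Lemma 2.10 — the tree's `SparseCholeskyRun.sub_mul_lt_quadForm_of_rowCounts`
(`SparseCholeskyCertificate`, certnum lit-1 FACT F1-13) and, for the stored zeros of the factor,
`SparseCholeskyRunFlush.sub_sub_mul_lt_quadForm_of_rowCounts_flush` (`SparseCholeskyStoredZeros`).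
Both are stated for the TEXTBOOK off-diagonal step `r̃_{ij} = fl(s̃ / r̃_{ii})` (one rounding).  Inside a
supernode the library runs LAPACK `dpotrf`/`dtrsm`, which SCALE by a rounded reciprocal,
`r̃_{ij} = fl(s̃ · fl(1/r̃_{ii}))` — two roundings (`Literature.ComputerArithmetic.Rump2006.CholeskyReciprocalDivision`,
seat certnum-ila-3: `CholeskyRunRecip`, and THE REDUCTION `CholeskyRunRecip.toCholeskyRun`: such a run is
a textbook run for `u' = 2u + u²`).  The engine (≥ 0.2.1) therefore evaluates every constant at
`u' = 2u + u²` — but the SPARSE run model had no reciprocal twin, so for the sparse constants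
(`alpha_rump2026`, `alpha_pattern`) that sentence was untyped.  This module types it:
* `SparseCholeskyRunRecip u A R̃ S` — lean-1's `SparseCholeskyRun` (any order, fused operations, pattern
  sets `S i j`) with the library off-diagonal step of `CholeskyRunRecip`; it contains the textbook sparse
  run (`SparseCholeskyRun.toRecip`, exact reciprocal) and the dense library run
  (`SparseCholeskyRunRecip.of_dense`, full index sets);
* `SparseCholeskyRunRecip.toSparseCholeskyRun` — THE REDUCTION: it IS a `SparseCholeskyRun (2u+u²) A R̃ S`
  (certnum-ila-3's `abs_sub_div_le_of_recip` + `CTree.WF.mono`, verbatim the dense proof);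
* `SparseCholeskyRunRecipFlush u E A R̃ S` — the same run in which a stored off-diagonal entry may also be
  a ZERO with an absolutely bounded numerator (`|s̃| ≤ E_{ij}`: CHOLMOD's relaxed-supernode padding,
  flushed or exact zeros; the shape of certnum-ila-3's dense `CholeskyRunRecipFlush`), its two inclusions,
  and `SparseCholeskyRunRecipFlush.toSparseCholeskyRunFlush` — it IS a `SparseCholeskyRunFlush (2u+u²)`;
* the two statements the engine evaluates, in that dress (one-line corollaries, recorded so that the
  certificate's `soundness` field names a theorem whose hypothesis it HAS):
  `SparseCholeskyRunRecip.sub_mul_lt_quadForm_of_rowCounts` ([Rump2026SparseI] Lemma 2.10 (2.15) floor,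
  Rump 2006 Cor 2.4 dress) and `SparseCholeskyRunRecipFlush.sub_sub_mul_lt_quadForm_of_rowCounts` /
  `mul_le_quadForm_of_rowCounts` (the members floor with stored zeros charged, Rump 2006 Cor 2.7 dress),
  every `γ`, `(1-u)^n` and the admissibility `(μ_i+1)u < 1` read at `u' = 2u + u²`.
For binary64 `u' = 2⁻⁵² + 2⁻¹⁰⁶`; measured price on the 2-D Laplacian (cap.ila.spd 0.2.1.dev24, kit
j272102): every `α` doubles, `lam_lo` moves by `6·10⁻¹¹` relative.

NOT HERE: the SHARP statement at the SAME `u` (the table condition `card (S i j) + 2 ≤ Φ_{ij}` of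
`SparseCholeskyRun.abs_sub_transpose_mul_self_le` has one spare rounding off the diagonal, so
certnum-ila-3's `CholeskyReciprocalDivisionSharp` argument ports to the sparse counts — not typed here);
block-inversion triangular solves (`TRTRI`+`GEMM`), Strassen products, extended formats, and `eta`
terms beyond the flushed quotients, exactly as in the parents.
[cite: Rump2026SparseI, Lemma 2.10] [cite: Rump2006, (2.1), (2.6), Corollaries 2.4 and 2.7]
[cite: Higham2002ASNA, Lemma 3.1 and Algorithm 10.2]

## Search record (TYPER LINT RULE)
`lean search 'SparseCholeskyRunRecip|SparseCholeskyReciprocal|toSparseCholeskyRun'` → none (2026-08-27);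
the dense reciprocal model and reduction are certnum-ila-3's `Rump2006.CholeskyReciprocalDivision`
(REUSED: `abs_sub_div_le_of_recip`, `CTree.WF.mono`, `CholeskyRunRecip`); the sparse model, certificate
and stored-zero files are `Rump2026SparseI.SparseCholesky{,Certificate,StoredZeros}` (REUSED, not restated).

AI-produced formalisation (cell certnum, seat certnum-ila-1 gen 5, 2026-08-27).
-/

namespace Literature.ComputerArithmetic.Rump2026SparseI

open Finset Matrix
open Literature.ComputerArithmetic.Higham2002
open Literature.ComputerArithmetic.Rump2006

variable {K : Type*} [Field K] [LinearOrder K] [IsStrictOrderedRing K]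

/-! ### The sparse run with reciprocal scaling -/

section Recip

variable {u : K} {n : ℕ}

/-- **Sparse floating-point Cholesky of LIBRARY SHAPE executed to completion**: exactly
`SparseCholeskyRun u A R̃ S` ([Rump2026SparseI] Lemma 2.10's run — stage `(i, j)` subtracts the products
`r̃_{ki} r̃_{kj}`, `k ∈ S i j`, by any well-formed evaluation tree, all other products `k < i` being zero)
except that the off-diagonal entry is obtained from the computed numerator `s̃` by a multiplication with a
ROUNDED RECIPROCAL of the pivot, `w = fl(1/r̃_{ii})`, `r̃_{ij} = fl(s̃ · w)` — two standard-model roundings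
(LAPACK `dpotf2`/`dtrsm` inside CHOLMOD's supernodes). [cite: Rump2026SparseI, Lemma 2.10]
[cite: Rump2006, (2.1) and (2.6)] [cite: Higham2002ASNA, Algorithm 10.2] -/
structure SparseCholeskyRunRecip (u : K) (A R : Matrix (Fin n) (Fin n) K)
    (S : Fin n → Fin n → Finset (Fin n)) : Prop where
  lower : ∀ i j : Fin n, j < i → R i j = 0
  subset : ∀ i j : Fin n, i ≤ j → ∀ k ∈ S i j, k < i
  zero : ∀ i j : Fin n, i ≤ j → ∀ k : Fin n, k < i → k ∉ S i j → R k i * R k j = 0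
  offDiag : ∀ i j : Fin n, i < j → ∃ e : CTree K, e.WF u ∧ e.const = A i j ∧
    e.terms.Perm (sprods R (S i j) i j) ∧ R i i ≠ 0 ∧
    ∃ w : K, |w - (R i i)⁻¹| ≤ u * |(R i i)⁻¹| ∧ |R i j - e.val * w| ≤ u * |e.val * w|
  diag : ∀ j : Fin n, ∃ e : CTree K, e.WF u ∧ e.const = A j j ∧ e.terms.Perm (sprods R (S j j) j j) ∧
    ∃ δ : K, |δ| ≤ u ∧ R j j ^ 2 = e.val * (1 + δ) ^ 2

variable {A R : Matrix (Fin n) (Fin n) K} {S : Fin n → Fin n → Finset (Fin n)}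

/-- The textbook sparse run (one true division) is a reciprocal run with the EXACT reciprocal
`w = r̃_{ii}⁻¹`. [cite: Rump2026SparseI, Lemma 2.10] [cite: Rump2006, (2.1) and (2.6)] -/
theorem SparseCholeskyRun.toRecip (hu : 0 ≤ u) (h : SparseCholeskyRun u A R S) :
    SparseCholeskyRunRecip u A R S where
  lower := h.lower
  subset := h.subset
  zero := h.zero
  offDiag i j hij := by
    obtain ⟨e, he, hc, hp, hii, hy⟩ := h.offDiag i j hij
    refine ⟨e, he, hc, hp, hii, (R i i)⁻¹, ?_, ?_⟩
    · rw [sub_self, abs_zero]; exact mul_nonneg hu (abs_nonneg _)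
    · rw [← div_eq_mul_inv]; exact hy
  diag := h.diag

omit [IsStrictOrderedRing K] in
/-- **The dense library run is an instance:** certnum-ila-3's `CholeskyRunRecip u A R̃` (every product
`k < i` subtracted, reciprocal scaling) is a `SparseCholeskyRunRecip` with the full index sets
`S i j = {k | k < i}`. [cite: Rump2006, (2.1) and (2.6)] [cite: Rump2026SparseI, Lemma 2.10] -/
theorem SparseCholeskyRunRecip.of_dense (h : CholeskyRunRecip u A R) :
    SparseCholeskyRunRecip u A R (fun i _ => univ.filter (· < i)) where
  lower := h.lower
  subset := fun i j _ k hk => (Finset.mem_filter.mp hk).2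
  zero := fun i j _ k hk hkS => (hkS (Finset.mem_filter.mpr ⟨Finset.mem_univ k, hk⟩)).elim
  offDiag := fun i j hij => by
    obtain ⟨e, he, hc, hp, hii, hw⟩ := h.offDiag i j hij
    exact ⟨e, he, hc, hp.trans (prods_perm_sprods R i j), hii, hw⟩
  diag := fun j => by
    obtain ⟨e, he, hc, hp, δ, hδ, hy⟩ := h.diag j
    exact ⟨e, he, hc, hp.trans (prods_perm_sprods R j j), δ, hδ, hy⟩

/-- **THE REDUCTION (sparse form):** a sparse Cholesky run whose off-diagonal step multiplies by a
rounded reciprocal is lean-1's textbook sparse run `SparseCholeskyRun` — same factor, same pattern sets —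
for the unit roundoff `2u + u²`; so every result of `SparseCholesky`, `SparseCholeskyCertificate` and
`SparseCholeskyStoredZeros` ([Rump2026SparseI] Lemma 2.10 and its certificate forms) applies to it with
`u' = 2u + u²` in place of `u`. [cite: Rump2026SparseI, Lemma 2.10] [cite: Higham2002ASNA, Lemma 3.1] -/
theorem SparseCholeskyRunRecip.toSparseCholeskyRun (hu : 0 ≤ u) (h : SparseCholeskyRunRecip u A R S) :
    SparseCholeskyRun (2 * u + u * u) A R S where
  lower := h.lower
  subset := h.subset
  zero := h.zero
  offDiag i j hij := by
    have huu : u ≤ 2 * u + u * u := by nlinarith [mul_nonneg hu hu]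
    obtain ⟨e, he, hc, hp, hii, w, hw, hy⟩ := h.offDiag i j hij
    exact ⟨e, CTree.WF.mono huu e he, hc, hp, hii, abs_sub_div_le_of_recip hu hw hy⟩
  diag j := by
    have huu : u ≤ 2 * u + u * u := by nlinarith [mul_nonneg hu hu]
    obtain ⟨e, he, hc, hp, δ, hδ, hy⟩ := h.diag j
    exact ⟨e, CTree.WF.mono huu e he, hc, hp, δ, hδ.trans huu, hy⟩

/-- nonnegativity of the doubled unit roundoff. [cite: Higham2002ASNA, Lemma 3.1] -/
theorem two_mul_add_mul_self_nonneg (hu : 0 ≤ u) : 0 ≤ 2 * u + u * u := by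
  nlinarith [mul_nonneg hu hu]

/-- **The F1-13 CERTIFICATE ROWS for a library-shape factor** (`lam_lo` of cap.ila.spd ≥ 0.2.1, sparse
constants `alpha_rump2026` / `alpha_pattern`): [Rump2026SparseI] Lemma 2.10's floor in the Rump 2006
Corollary 2.4 dress, `SparseCholeskyRun.sub_mul_lt_quadForm_of_rowCounts`, for a `SparseCholeskyRunRecip u`
of the shifted matrix `Ã` with positive computed pivots — row-count table `μ` of a pattern `P ⊇ S`,
admissibility `(μ_i + 1)·u' < 1`, column norms `(1 + γ_{μ_j+1}(u')) ã_{jj} ≤ d_j²`, Collatz pair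
`M(u') v ≤ c v` — EVERY constant read at `u' = 2u + u²`: then `(s - c)·xᵀx < xᵀAx` for `x ≠ 0`.
[cite: Rump2026SparseI, Lemma 2.10 (2.15)] [cite: Rump2006, Corollary 2.4] [cite: Higham2002ASNA, Lemma 3.1] -/
theorem SparseCholeskyRunRecip.sub_mul_lt_quadForm_of_rowCounts (hu : 0 ≤ u)
    (hu1 : 2 * u + u * u < 1)
    {A At R : Matrix (Fin n) (Fin n) K} {S : Fin n → Fin n → Finset (Fin n)} (hAt : Atᵀ = At)
    (hrun : SparseCholeskyRunRecip u At R S) (hpos : ∀ j, 0 < R j j)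
    {P : Fin n → Finset (Fin n)} (hSP : ∀ i j : Fin n, i ≤ j → S i j ⊆ P i ∩ P j)
    (hPdiag : ∀ i, i ∈ P i) {μ : Fin n → ℕ} (hμ : ∀ i, (P i).card ≤ μ i)
    (hμu : ∀ i, ((μ i + 1 : ℕ) : K) * (2 * u + u * u) < 1)
    {d : Fin n → K} (hd0 : ∀ j, 0 ≤ d j)
    (hd : ∀ j, (1 + gamma (2 * u + u * u) (μ j + 1)) * At j j ≤ d j ^ 2)
    {v : Fin n → K} (hv : ∀ i, 0 < v i) {c : K}
    (hc : ∀ i, (errMatrix (2 * u + u * u) (fun i j => min (μ i) (μ j) + 1) d *ᵥ v) i ≤ c * v i)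
    {s : K} (hoff : ∀ i j, i ≠ j → At i j = A i j) (hdiag : ∀ i, At i i ≤ A i i - s)
    (x : Fin n → K) (hx : x ≠ 0) : (s - c) * (x ⬝ᵥ x) < x ⬝ᵥ (A *ᵥ x) :=
  SparseCholeskyRun.sub_mul_lt_quadForm_of_rowCounts (two_mul_add_mul_self_nonneg hu) hu1 hAt
    (hrun.toSparseCholeskyRun hu) hpos hSP hPdiag hμ hμu hd0 hd hv hc hoff hdiag x hx

end Recip

/-! ### Stored zeros over the sparse run with reciprocal scaling -/

section RecipFlush

variable {u : K} {n : ℕ}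

/-- The sparse library-shape run (`SparseCholeskyRunRecip`) in which a stored off-diagonal entry may
also be a ZERO whose numerator is only bounded absolutely, `r̃_{ij} = 0 ∧ |s̃_{ij}| ≤ E_{ij}` (quotient
flushed to zero by underflow, or an exact zero: the explicit zeros of a relaxed-supernode factor) — what
a CHOLMOD supernodal factor certifies under the standard model with gradual underflow; the sparse
reading of certnum-ila-3's `CholeskyRunRecipFlush`. [cite: Rump2026SparseI, Lemma 2.10]
[cite: Rump2006, (1.1), (2.1) and (2.6)] [cite: Higham2002ASNA, Algorithm 10.2] -/
structure SparseCholeskyRunRecipFlush (u : K) (E A R : Matrix (Fin n) (Fin n) K)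
    (S : Fin n → Fin n → Finset (Fin n)) : Prop where
  lower : ∀ i j : Fin n, j < i → R i j = 0
  subset : ∀ i j : Fin n, i ≤ j → ∀ k ∈ S i j, k < i
  zero : ∀ i j : Fin n, i ≤ j → ∀ k : Fin n, k < i → k ∉ S i j → R k i * R k j = 0
  offDiag : ∀ i j : Fin n, i < j → ∃ e : CTree K, e.WF u ∧ e.const = A i j ∧
    e.terms.Perm (sprods R (S i j) i j) ∧ R i i ≠ 0 ∧
    ((∃ w : K, |w - (R i i)⁻¹| ≤ u * |(R i i)⁻¹| ∧ |R i j - e.val * w| ≤ u * |e.val * w|) ∨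
      (R i j = 0 ∧ |e.val| ≤ E i j))
  diag : ∀ j : Fin n, ∃ e : CTree K, e.WF u ∧ e.const = A j j ∧ e.terms.Perm (sprods R (S j j) j j) ∧
    ∃ δ : K, |δ| ≤ u ∧ R j j ^ 2 = e.val * (1 + δ) ^ 2

variable {E A R : Matrix (Fin n) (Fin n) K} {S : Fin n → Fin n → Finset (Fin n)}

omit [IsStrictOrderedRing K] in
/-- a sparse reciprocal run is a sparse reciprocal flush run for every allowance `E`.
[cite: Rump2026SparseI, Lemma 2.10] -/
theorem SparseCholeskyRunRecip.toRecipFlush (h : SparseCholeskyRunRecip u A R S) :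
    SparseCholeskyRunRecipFlush u E A R S where
  lower := h.lower
  subset := h.subset
  zero := h.zero
  offDiag i j hij := by
    obtain ⟨e, he, hc, hp, hii, hw⟩ := h.offDiag i j hij
    exact ⟨e, he, hc, hp, hii, Or.inl hw⟩
  diag := h.diag

/-- a sparse textbook flush run (certnum-ila-1's `SparseCholeskyRunFlush`, one true division) is a sparse
reciprocal flush run with the exact reciprocal. [cite: Rump2026SparseI, Lemma 2.10] [cite: Rump2006, (1.1)] -/
theorem SparseCholeskyRunFlush.toRecipFlush (hu : 0 ≤ u) (h : SparseCholeskyRunFlush u E A R S) :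
    SparseCholeskyRunRecipFlush u E A R S where
  lower := h.lower
  subset := h.subset
  zero := h.zero
  offDiag i j hij := by
    obtain ⟨e, he, hc, hp, hii, hr⟩ := h.offDiag i j hij
    refine ⟨e, he, hc, hp, hii, ?_⟩
    rcases hr with hy | hz
    · refine Or.inl ⟨(R i i)⁻¹, ?_, ?_⟩
      · rw [sub_self, abs_zero]; exact mul_nonneg hu (abs_nonneg _)
      · rw [← div_eq_mul_inv]; exact hy
    · exact Or.inr hz
  diag := h.diag

/-- **THE REDUCTION with stored zeros:** a sparse reciprocal flush run is certnum-ila-1's textbook sparse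
flush run `SparseCholeskyRunFlush` — same factor, same pattern sets, SAME allowance `E` — for the unit
roundoff `2u + u²` (the flush disjunct does not involve `u`). [cite: Rump2026SparseI, Lemma 2.10]
[cite: Rump2006, (1.1)] [cite: Higham2002ASNA, Lemma 3.1] -/
theorem SparseCholeskyRunRecipFlush.toSparseCholeskyRunFlush (hu : 0 ≤ u)
    (h : SparseCholeskyRunRecipFlush u E A R S) :
    SparseCholeskyRunFlush (2 * u + u * u) E A R S where
  lower := h.lower
  subset := h.subset
  zero := h.zero
  offDiag i j hij := by
    have huu : u ≤ 2 * u + u * u := by nlinarith [mul_nonneg hu hu]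
    obtain ⟨e, he, hc, hp, hii, hr⟩ := h.offDiag i j hij
    refine ⟨e, CTree.WF.mono huu e he, hc, hp, hii, ?_⟩
    rcases hr with ⟨w, hw, hy⟩ | hz
    · exact Or.inl (abs_sub_div_le_of_recip hu hw hy)
    · exact Or.inr hz
  diag j := by
    have huu : u ≤ 2 * u + u * u := by nlinarith [mul_nonneg hu hu]
    obtain ⟨e, he, hc, hp, δ, hδ, hy⟩ := h.diag j
    exact ⟨e, CTree.WF.mono huu e he, hc, hp, δ, hδ.trans huu, hy⟩

/-- STORED ZEROS COST A RADIUS (sparse library form): a sparse reciprocal flush run of a symmetric `A`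
with allowance `E ≥ 0` is an `eta`-free `SparseCholeskyRun (2u+u²)` — same factor, same pattern sets —
of a SYMMETRIC `A'` with the same diagonal and `|A' - A| (1-u')^n ≤ E`, `u' = 2u + u²`.
[cite: Rump2026SparseI, Lemma 2.10] [cite: Rump2006, Lemma 2.1, (1.1) and Corollary 2.7] -/
theorem SparseCholeskyRunRecipFlush.exists_sparseCholeskyRun (hu : 0 ≤ u) (hu1 : 2 * u + u * u < 1)
    (hA : Aᵀ = A) (hE0 : ∀ i j, 0 ≤ E i j) (h : SparseCholeskyRunRecipFlush u E A R S) :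
    ∃ A' : Matrix (Fin n) (Fin n) K, A'ᵀ = A' ∧ SparseCholeskyRun (2 * u + u * u) A' R S ∧
      (∀ i, A' i i = A i i) ∧
      ∀ i j, |A' i j - A i j| * (1 - (2 * u + u * u)) ^ n ≤ (if i < j then E i j else E j i) :=
  (h.toSparseCholeskyRunFlush hu).exists_sparseCholeskyRun (two_mul_add_mul_self_nonneg hu) hu1 hA hE0

namespace SparseCholeskyRunRecipFlush

/-- **The MEMBERS floor with STORED ZEROS CHARGED for a library-shape factor** (`lam_lo_members` /
`lam_lo` of cap.ila.spd ≥ 0.2.1, `checks.eta_allowance = r_E`): certnum-ila-1's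
`SparseCholeskyRunFlush.sub_sub_mul_lt_quadForm_of_rowCounts_flush` for a `SparseCholeskyRunRecipFlush u`
— row-count table `μ`, admissibility, column norms `d`, Collatz pair `(v, c)` for the error matrix, the
flush allowance's Collatz pair `E v' ≤ r_E (1-u')^n v'`, shift `s`, symmetric radius `Rad ≥ 0` with
Collatz pair `(w, r)`, EVERY constant read at `u' = 2u + u²`: every `X` with `|X - A| ≤ Rad` satisfies
`(s - c - r - r_E)·yᵀy < yᵀXy` for `y ≠ 0`. [cite: Rump2026SparseI, Lemma 2.10 (2.15) with Thm 1.1 (1.4)]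
[cite: Rump2006, Corollary 2.7, (2.11)–(2.12) and (1.1)] [cite: Higham2002ASNA, Lemma 3.1] -/
theorem sub_sub_mul_lt_quadForm_of_rowCounts (hu : 0 ≤ u) (hu1 : 2 * u + u * u < 1)
    {A At R E : Matrix (Fin n) (Fin n) K} {S : Fin n → Fin n → Finset (Fin n)} (hAt : Atᵀ = At)
    (hE : Eᵀ = E) (hE0 : ∀ i j, 0 ≤ E i j) (hrun : SparseCholeskyRunRecipFlush u E At R S)
    (hpos : ∀ j, 0 < R j j)
    {P : Fin n → Finset (Fin n)} (hSP : ∀ i j : Fin n, i ≤ j → S i j ⊆ P i ∩ P j)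
    (hPdiag : ∀ i, i ∈ P i) {μ : Fin n → ℕ} (hμ : ∀ i, (P i).card ≤ μ i)
    (hμu : ∀ i, ((μ i + 1 : ℕ) : K) * (2 * u + u * u) < 1)
    {d : Fin n → K} (hd0 : ∀ j, 0 ≤ d j)
    (hd : ∀ j, (1 + gamma (2 * u + u * u) (μ j + 1)) * At j j ≤ d j ^ 2)
    {v : Fin n → K} (hv : ∀ i, 0 < v i) {c : K}
    (hc : ∀ i, (errMatrix (2 * u + u * u) (fun i j => min (μ i) (μ j) + 1) d *ᵥ v) i ≤ c * v i)
    {v' : Fin n → K} (hv' : ∀ i, 0 < v' i) {rE : K}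
    (hrE : ∀ i, (E *ᵥ v') i ≤ rE * (1 - (2 * u + u * u)) ^ n * v' i)
    {s : K} (hoff : ∀ i j, i ≠ j → At i j = A i j) (hdiag : ∀ i, At i i ≤ A i i - s)
    {Rad : Matrix (Fin n) (Fin n) K} (hRad : Radᵀ = Rad) (hRad0 : ∀ i j, 0 ≤ Rad i j)
    {w : Fin n → K} (hw : ∀ i, 0 < w i) {r : K} (hr : ∀ i, (Rad *ᵥ w) i ≤ r * w i)
    (X : Matrix (Fin n) (Fin n) K) (hX : ∀ i j, |X i j - A i j| ≤ Rad i j)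
    (y : Fin n → K) (hy : y ≠ 0) : (s - c - r - rE) * (y ⬝ᵥ y) < y ⬝ᵥ (X *ᵥ y) :=
  (hrun.toSparseCholeskyRunFlush hu).sub_sub_mul_lt_quadForm_of_rowCounts_flush
    (two_mul_add_mul_self_nonneg hu) hu1 hAt hE hE0 hpos hSP hPdiag hμ hμu hd0 hd hv hc hv' hrE hoff
    hdiag hRad hRad0 hw hr X hX y hy

/-- Rayleigh-quotient form of `sub_sub_mul_lt_quadForm_of_rowCounts` for ALL `y` (what a client reads
as `lam ≤ λ_min(X)` for every member `X`): `lam ≤ s - c - r - r_E` gives `lam·yᵀy ≤ yᵀXy`, all constants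
at `u' = 2u + u²`. [cite: Rump2026SparseI, Lemma 2.10 (2.15)] [cite: Rump2006, Corollary 2.7 and (1.1)] -/
theorem mul_le_quadForm_of_rowCounts (hu : 0 ≤ u) (hu1 : 2 * u + u * u < 1)
    {A At R E : Matrix (Fin n) (Fin n) K} {S : Fin n → Fin n → Finset (Fin n)} (hAt : Atᵀ = At)
    (hE : Eᵀ = E) (hE0 : ∀ i j, 0 ≤ E i j) (hrun : SparseCholeskyRunRecipFlush u E At R S)
    (hpos : ∀ j, 0 < R j j)
    {P : Fin n → Finset (Fin n)} (hSP : ∀ i j : Fin n, i ≤ j → S i j ⊆ P i ∩ P j)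
    (hPdiag : ∀ i, i ∈ P i) {μ : Fin n → ℕ} (hμ : ∀ i, (P i).card ≤ μ i)
    (hμu : ∀ i, ((μ i + 1 : ℕ) : K) * (2 * u + u * u) < 1)
    {d : Fin n → K} (hd0 : ∀ j, 0 ≤ d j)
    (hd : ∀ j, (1 + gamma (2 * u + u * u) (μ j + 1)) * At j j ≤ d j ^ 2)
    {v : Fin n → K} (hv : ∀ i, 0 < v i) {c : K}
    (hc : ∀ i, (errMatrix (2 * u + u * u) (fun i j => min (μ i) (μ j) + 1) d *ᵥ v) i ≤ c * v i)
    {v' : Fin n → K} (hv' : ∀ i, 0 < v' i) {rE : K}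
    (hrE : ∀ i, (E *ᵥ v') i ≤ rE * (1 - (2 * u + u * u)) ^ n * v' i)
    {s : K} (hoff : ∀ i j, i ≠ j → At i j = A i j) (hdiag : ∀ i, At i i ≤ A i i - s)
    {Rad : Matrix (Fin n) (Fin n) K} (hRad : Radᵀ = Rad) (hRad0 : ∀ i j, 0 ≤ Rad i j)
    {w : Fin n → K} (hw : ∀ i, 0 < w i) {r : K} (hr : ∀ i, (Rad *ᵥ w) i ≤ r * w i)
    {lam : K} (hlam : lam ≤ s - c - r - rE)
    (X : Matrix (Fin n) (Fin n) K) (hX : ∀ i j, |X i j - A i j| ≤ Rad i j)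
    (y : Fin n → K) : lam * (y ⬝ᵥ y) ≤ y ⬝ᵥ (X *ᵥ y) :=
  (hrun.toSparseCholeskyRunFlush hu).mul_le_quadForm_of_rowCounts_flush
    (two_mul_add_mul_self_nonneg hu) hu1 hAt hE hE0 hpos hSP hPdiag hμ hμu hd0 hd hv hc hv' hrE hoff
    hdiag hRad hRad0 hw hr hlam X hX y

end SparseCholeskyRunRecipFlush

end RecipFlush

end Literature.ComputerArithmetic.Rump2026SparseI
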